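import Literature.IUT.HodgeTheaters.DiscreteProfiniteCompletionsHCS
import Literature.IUT.HodgeTheaters.DiscreteProfiniteCompletionsAssembly
import HarnessLib

/-!
# [IUTchI] Thm 2.6 / Cor 2.8 / Lem 2.7 (vi)(vii): the ORIENTABLE-SURFACE halves of the named
# statements, reduced to four properties of orientable surface groups

Mochizuki, *Inter-universal Teichmüller theory I*, kurims manuscript (May 2020), §2, Theorem 2.6 p. 56,
Lemma 2.7 (vi)(vii) p. 58, Corollary 2.8 p. 59, proofs pp. 56–59 [cite: Mochizuki2012, Thm 2.6 pp.56-59]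
(D-0012 claim key; series status DISPUTED — the content of this file is classical combinatorial /
profinite group theory; Remark 2.8.1: the surface case is OFF the route used in [IUTchI–IV]).

The named statements `ProfiniteConjugatesOfDiscreteSubgroups` (Thm 2.6), `SubgroupsOfComplexHyperbolicPi1`
(Cor 2.8), `FreeOrSurface.centralizerCommutatorKernelTrivial` (Lem 2.7 (vi)) and
`FreeOrSurface.autFixingCommutatorKernelTrivial` (Lem 2.7 (vii)) quantify over groups that are free of
finite rank OR orientable surface groups.  Their FREE halves are theorems of the tree (abc-iut-L5-t9:
`profiniteConjugates_freeCase`, `centralizerCommutatorKernelTrivial_freeCase`, …) and t9's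
`…_of_surfaceCase` reductions leave exactly the orientable-surface halves.  This file derives those
halves — hence the four NAMED STATEMENTS AS TYPED — from FOUR properties of orientable surface groups,
carried as explicit hypotheses (typed ≠ discharged):

* (HCS) every finite-index subgroup of an orientable surface group is conjugacy separable — [Stb2]
  P. Stebe, Trans. AMS 163 (1972), Thm 3.3 ("the content of [Stb2], Theorem 3.3, when `G` is an
  orientable surface group", p. 57 l. 9), together with the classical fact that finite-index subgroups
  of orientable surface groups are orientable surface groups (used on p. 58: "the abelianization of
  any finite index subgroup of `G` is torsion-free");
* (III) the orientable-surface half of Lemma 2.7 (iii) (abc-iut-L5-d1);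
* (Z)   centralizers of non-trivial elements of an orientable surface group are cyclic (abc-iut-L5-d1,
  amalgam route `S_{g+h} ≅ F_{2g} *_ℤ F_{2h}`);
* (FG)  orientable surface groups are finitely generated (immediate from the presentation);
  and, for Theorem 2.6 (a) only, (IV) the orientable-surface half of Lemma 2.7 (iv) (abc-iut-L5-d1).

What is PROVED here without hypotheses: a nonabelian-commutator witness for surface groups
(`SurfaceGroup.toFreeGroup`-free: the surjection `S_g ↠ F_g`, `a_i ↦ x_i`, `b_i ↦ 1`, pulls back two
non-commuting commutators of `F_g`), and the deduction of Lemma 2.7 (vi) from Theorem 2.6 (b) exactly as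
in the free case (t9): `z ∈ Z_Ĝ(N̂)` conjugates `η([G,G])` into `η(G)`, so `z = η(g₀)` by Theorem 2.6 (b)
(`H = [G, G]` is nonabelian), and `g₀` centralizes two non-commuting elements, whence `g₀ = 1` by (Z);
injectivity of `η` (residual finiteness) comes from conjugacy separability
(`residuallyFinite_of_conjSeparable`).  Lemma 2.7 (v) for surface groups is NOT used and NOT claimed.
Proof-only file; no statement of the tree is restated or weakened.
-/

namespace Literature.IUT.HodgeTheaters

open scoped Pointwise
open ProfiniteCompletion

universe u

/-! ### Non-commuting commutators in orientable surface groups -/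

/-- The surjection `S_g ↠ F_g` killing the `b_i`: the surface relator `∏ [a_i, b_i]` maps to `1`.
[cite: Mochizuki2012, Lem 2.7(vi) p.59] -/
theorem surfaceRelator_lift_eq_one (g : ℕ) :
    FreeGroup.lift (Sum.elim FreeGroup.of (fun _ : Fin g => (1 : FreeGroup (Fin g)))) (surfaceRelator g) = 1 := by
  rw [surfaceRelator, map_list_prod, List.map_map]
  apply List.prod_eq_one
  intro x hx
  rw [List.mem_map] at hx
  obtain ⟨i, -, rfl⟩ := hx
  simp

/-- There is a surjective homomorphism from the surface group of genus `g` onto the free group of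
rank `g` (`a_i ↦ x_i`, `b_i ↦ 1`). [cite: Mochizuki2012, Lem 2.7(vi) p.59] -/
theorem SurfaceGroup.exists_surjective_toFreeGroup (g : ℕ) :
    ∃ φ : SurfaceGroup g →* FreeGroup (Fin g), Function.Surjective φ := by
  let f : Fin g ⊕ Fin g → FreeGroup (Fin g) := Sum.elim FreeGroup.of fun _ => 1
  have hf : ∀ r ∈ ({surfaceRelator g} : Set (FreeGroup (Fin g ⊕ Fin g))), FreeGroup.lift f r = 1 := by
    intro r hr
    rw [Set.mem_singleton_iff] at hr
    subst hr
    exact surfaceRelator_lift_eq_one g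
  refine ⟨PresentedGroup.toGroup hf, ?_⟩
  rw [← MonoidHom.range_eq_top, eq_top_iff, ← FreeGroup.closure_range_of, Subgroup.closure_le]
  rintro _ ⟨i, rfl⟩
  exact ⟨PresentedGroup.of (Sum.inl i), by rw [PresentedGroup.toGroup.of]; rfl⟩

/-- Two free generators `x_i, x_j` (`i ≠ j`) of `F_g` do not commute (seen in `S₃`).
[cite: Mochizuki2012, Lem 2.7(vi) p.59] -/
theorem FreeGroup.of_mul_of_ne_of_ne' {ι : Type*} {i j : ι} (hij : i ≠ j) :
    (FreeGroup.of i : FreeGroup ι) * FreeGroup.of j ≠ FreeGroup.of j * FreeGroup.of i := by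
  classical
  let f : ι → Equiv.Perm (Fin 3) := fun c =>
    if c = i then Equiv.swap 0 1 else if c = j then Equiv.swap 1 2 else 1
  have hfi : f i = Equiv.swap 0 1 := by simp [f]
  have hfj : f j = Equiv.swap 1 2 := by simp [f, Ne.symm hij]
  intro h
  have h' := congrArg (FreeGroup.lift f) h
  simp only [map_mul, FreeGroup.lift_apply_of, hfi, hfj] at h'
  exact absurd h' (by decide)

/-- Non-commuting elements of the commutator subgroup pull back along a surjection.
[cite: Mochizuki2012, Lem 2.7(vi) p.59] -/
theorem exists_noncomm_mem_commutator_of_surjective {G : Type*} [Group G] {H : Type*} [Group H]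
    (φ : G →* H) (hφ : Function.Surjective φ)
    (h : ∃ x ∈ commutator H, ∃ y ∈ commutator H, x * y ≠ y * x) :
    ∃ x ∈ commutator G, ∃ y ∈ commutator G, x * y ≠ y * x := by
  obtain ⟨x, hx, y, hy, hxy⟩ := h
  have hmap : (commutator G).map φ = commutator H := by
    rw [commutator_def, commutator_def, Subgroup.map_commutator, ← MonoidHom.range_eq_map,
      MonoidHom.range_eq_top.mpr hφ]
  rw [← hmap] at hx hy
  obtain ⟨x', hx', rfl⟩ := hx
  obtain ⟨y', hy', rfl⟩ := hy
  exact ⟨x', hx', y', hy', fun hc => hxy (by rw [← map_mul, ← map_mul, hc])⟩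

/-- **An orientable surface group has two non-commuting elements in its commutator subgroup**
("`N` is nonabelian", p. 59: pull back `[x₁, x₂]`, `[x₁⁻¹, x₂]` along `S_g ↠ F_g`, `g ≥ 2`).
[cite: Mochizuki2012, Lem 2.7(vi) p.59] -/
theorem FreeOrSurface.exists_noncomm_mem_commutator_surfaceCase (G : Type u) [Group G]
    (hG : IsOrientableSurfaceGroup G) :
    ∃ x ∈ commutator G, ∃ y ∈ commutator G, x * y ≠ y * x := by
  obtain ⟨g, hg, ⟨e⟩⟩ := hG
  obtain ⟨φ, hφ⟩ := SurfaceGroup.exists_surjective_toFreeGroup g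
  have h2 : ∃ x y : FreeGroup (Fin g), x * y ≠ y * x :=
    ⟨FreeGroup.of ⟨0, by omega⟩, FreeGroup.of ⟨1, by omega⟩,
      FreeGroup.of_mul_of_ne_of_ne' (by simp [Fin.ext_iff])⟩
  have hF := FreeOrSurface.exists_noncomm_mem_commutator (FreeGroup (Fin g)) h2
  exact exists_noncomm_mem_commutator_of_surjective (φ.comp e.toMonoidHom)
    (hφ.comp e.surjective) hF

/-! ### Theorem 2.6 and Corollary 2.8 from the surface properties -/

section Surface

/-- **Theorem 2.6, the named statement, from (HCS), (III), (Z), (IV), (FG) for orientable surface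
groups** (the free half being the tree's unconditional `profiniteConjugates_freeCase`, via t9's
`profiniteConjugatesOfDiscreteSubgroups_of_surfaceCase`). [cite: Mochizuki2012, Thm 2.6 pp.56-57] -/
theorem profiniteConjugatesOfDiscreteSubgroups_of_surfaceHCS
    (hHCS : ∀ (S : Type u) [Group S], IsOrientableSurfaceGroup S → ∀ K : Subgroup S, K.FiniteIndex →
      ∀ u v : K, ¬ IsConj u v → ∃ (L : Subgroup K) (_ : L.Normal) (_ : L.FiniteIndex),
        ¬ IsConj (QuotientGroup.mk u : K ⧸ L) (QuotientGroup.mk v))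
    (hIII : ∀ (S : Type u) [Group S], IsOrientableSurfaceGroup S → ∀ x y : S, x * y ≠ y * x →
      ∃ (S₁ : Subgroup S) (n : ℕ) (hx : x ^ n ∈ S₁) (hy : y ^ n ∈ S₁), S₁.FiniteIndex ∧ 0 < n ∧
        ∀ i j : ℤ, Abelianization.of (⟨x ^ n, hx⟩ : S₁) ^ i *
          Abelianization.of (⟨y ^ n, hy⟩ : S₁) ^ j = 1 → i = 0 ∧ j = 0)
    (hZ : ∀ (S : Type u) [Group S], IsOrientableSurfaceGroup S → ∀ u : S, u ≠ 1 →
      IsCyclic (Subgroup.centralizer ({u} : Set S)))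
    (hIV : ∀ (S : Type u) [Group S], IsOrientableSurfaceGroup S →
      ∀ J : Subgroup S, (∀ a ∈ J, ∀ b ∈ J, a * b = b * a) → IsCyclic J)
    (hFG : ∀ (S : Type u) [Group S], IsOrientableSurfaceGroup S → Group.FG S) :
    ProfiniteConjugatesOfDiscreteSubgroups.{u} := by
  refine profiniteConjugatesOfDiscreteSubgroups_of_surfaceCase ?_
  intro F _ G H hGfi hG _hH γ hγ
  haveI := hGfi
  refine profiniteConjugates_of_hcs G H (hFG G hG) ?_ (hIII G hG) (hZ G hG) (hIV G hG) γ hγ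
  intro K hKG hKfi
  haveI := hKfi
  exact ProfiniteCompletion.hcs_subgroup_of_hcs G (hHCS G hG) K hKG

/-- **Corollary 2.8, the named statement, from the same properties of orientable surface groups**
(Remark 2.8.1's deduction, t1's `subgroupsOfComplexHyperbolicPi1_of_thm26`).
[cite: Mochizuki2012, Cor 2.8 p.59] -/
theorem subgroupsOfComplexHyperbolicPi1_of_surfaceHCS
    (hHCS : ∀ (S : Type u) [Group S], IsOrientableSurfaceGroup S → ∀ K : Subgroup S, K.FiniteIndex →
      ∀ u v : K, ¬ IsConj u v → ∃ (L : Subgroup K) (_ : L.Normal) (_ : L.FiniteIndex),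
        ¬ IsConj (QuotientGroup.mk u : K ⧸ L) (QuotientGroup.mk v))
    (hIII : ∀ (S : Type u) [Group S], IsOrientableSurfaceGroup S → ∀ x y : S, x * y ≠ y * x →
      ∃ (S₁ : Subgroup S) (n : ℕ) (hx : x ^ n ∈ S₁) (hy : y ^ n ∈ S₁), S₁.FiniteIndex ∧ 0 < n ∧
        ∀ i j : ℤ, Abelianization.of (⟨x ^ n, hx⟩ : S₁) ^ i *
          Abelianization.of (⟨y ^ n, hy⟩ : S₁) ^ j = 1 → i = 0 ∧ j = 0)
    (hZ : ∀ (S : Type u) [Group S], IsOrientableSurfaceGroup S → ∀ u : S, u ≠ 1 →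
      IsCyclic (Subgroup.centralizer ({u} : Set S)))
    (hIV : ∀ (S : Type u) [Group S], IsOrientableSurfaceGroup S →
      ∀ J : Subgroup S, (∀ a ∈ J, ∀ b ∈ J, a * b = b * a) → IsCyclic J)
    (hFG : ∀ (S : Type u) [Group S], IsOrientableSurfaceGroup S → Group.FG S) :
    SubgroupsOfComplexHyperbolicPi1.{u} :=
  subgroupsOfComplexHyperbolicPi1_of_thm26
    (profiniteConjugatesOfDiscreteSubgroups_of_surfaceHCS hHCS hIII hZ hIV hFG)

end Surface

/-! ### Lemma 2.7 (vi) and (vii) from the surface properties -/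

namespace FreeOrSurface

/-- Conjugacy separability of `S` itself from the hereditary hypothesis (applied to `K = ⊤`).
[cite: Mochizuki2012, Thm 2.6 p.57] -/
theorem conjSeparable_of_hcs_top {S : Type u} [Group S]
    (hS : ∀ K : Subgroup S, K.FiniteIndex → ∀ u v : K, ¬ IsConj u v →
      ∃ (L : Subgroup K) (_ : L.Normal) (_ : L.FiniteIndex),
        ¬ IsConj (QuotientGroup.mk u : K ⧸ L) (QuotientGroup.mk v)) :
    ∀ u v : S, ¬ IsConj u v → ∃ (L : Subgroup S) (_ : L.Normal) (_ : L.FiniteIndex),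
      ¬ IsConj (QuotientGroup.mk u : S ⧸ L) (QuotientGroup.mk v) :=
  ProfiniteCompletion.conjSeparable_of_mulEquiv Subgroup.topEquiv.symm (hS ⊤ inferInstance)

/-- **Lemma 2.7 (vi), orientable-surface half, from (HCS), (III), (Z), (FG)**: for `G` an orientable
surface group the centralizer `Z_Ĝ(N̂)` of `N̂ = Ker(Ĝ ↠ Ĝ^{ab})` is trivial.  Route: Theorem 2.6 (b)
(abstract form, `F = G`, `H = [G, G]`) + non-commuting commutators + cyclic centralizers; `η` is
injective because conjugacy separable groups are residually finite.
[cite: Mochizuki2012, Lem 2.7(vi) pp.58-59] -/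
theorem centralizerCommutatorKernelTrivial_surfaceCase_of_surfaceHCS
    (hHCS : ∀ (S : Type u) [Group S], IsOrientableSurfaceGroup S → ∀ K : Subgroup S, K.FiniteIndex →
      ∀ u v : K, ¬ IsConj u v → ∃ (L : Subgroup K) (_ : L.Normal) (_ : L.FiniteIndex),
        ¬ IsConj (QuotientGroup.mk u : K ⧸ L) (QuotientGroup.mk v))
    (hIII : ∀ (S : Type u) [Group S], IsOrientableSurfaceGroup S → ∀ x y : S, x * y ≠ y * x →
      ∃ (S₁ : Subgroup S) (n : ℕ) (hx : x ^ n ∈ S₁) (hy : y ^ n ∈ S₁), S₁.FiniteIndex ∧ 0 < n ∧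
        ∀ i j : ℤ, Abelianization.of (⟨x ^ n, hx⟩ : S₁) ^ i *
          Abelianization.of (⟨y ^ n, hy⟩ : S₁) ^ j = 1 → i = 0 ∧ j = 0)
    (hZ : ∀ (S : Type u) [Group S], IsOrientableSurfaceGroup S → ∀ u : S, u ≠ 1 →
      IsCyclic (Subgroup.centralizer ({u} : Set S)))
    (hFG : ∀ (S : Type u) [Group S], IsOrientableSurfaceGroup S → Group.FG S)
    (G : Type u) [Group G] (hG : IsOrientableSurfaceGroup G) :
    Subgroup.centralizer (commutatorKernel G : Set (profiniteCompletion G)) = ⊥ := by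
  -- `η : G → Ĝ` is injective: `G` is conjugacy separable, hence residually finite
  haveI hRF : Group.ResiduallyFinite G :=
    residuallyFinite_of_conjSeparable (conjSeparable_of_hcs_top (hHCS G hG))
  have hinj : Function.Injective (toCompletion G) := by
    have h := (ProfiniteGrp.ProfiniteCompletion.etaFn_injective_iff_residuallyFinite (GrpCat.of G)).mpr
      hRF
    exact fun x y hxy => h hxy
  -- the hypotheses at the finite-index subgroup `⊤ ⊆ G` (itself an orientable surface group)
  have htop : IsOrientableSurfaceGroup (⊤ : Subgroup G) :=
    IsOrientableSurfaceGroup.of_mulEquiv Subgroup.topEquiv hG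
  have hHCStop : ∀ K : Subgroup G, K ≤ ⊤ → K.FiniteIndex → ∀ u v : K, ¬ IsConj u v →
      ∃ (L : Subgroup K) (_ : L.Normal) (_ : L.FiniteIndex),
        ¬ IsConj (QuotientGroup.mk u : K ⧸ L) (QuotientGroup.mk v) :=
    fun K _ hKfi => hHCS G hG K hKfi
  rw [eq_bot_iff]
  intro z hz
  rw [Subgroup.mem_bot]
  rw [Subgroup.mem_centralizer_iff] at hz
  -- `z` centralizes `η([G, G])`, hence conjugates it into `η(G)`
  have hγ : ∀ h ∈ commutator G, z * toCompletion G h * z⁻¹ ∈ (toCompletion G).range := by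
    intro h hh
    refine ⟨h, ?_⟩
    have := hz (toCompletion G h) (toCompletion_mem_commutatorKernel G hh)
    rw [← this, mul_inv_cancel_right]
  -- `[G, G]` is nonabelian
  obtain ⟨x, hx, y, hy, hxy⟩ := exists_noncomm_mem_commutator_surfaceCase G hG
  have hna : ∃ x ∈ commutator G ⊓ ⊤, ∃ y ∈ commutator G ⊓ ⊤, x * y ≠ y * x :=
    ⟨x, Subgroup.mem_inf.mpr ⟨hx, Subgroup.mem_top x⟩, y, Subgroup.mem_inf.mpr ⟨hy, Subgroup.mem_top y⟩,
      hxy⟩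
  -- Theorem 2.6 (b), abstract form, with `F = G ⊇ ⊤`, `H = [G, G]`
  obtain ⟨g₀, hg₀⟩ := profiniteConjugates_b_of_hcs (⊤ : Subgroup G) (commutator G) (hFG _ htop)
    hHCStop (hZ _ htop) (hIII _ htop) z hγ hna
  -- `g₀` centralizes `[G, G]` in `G`
  have hcomm : ∀ n ∈ commutator G, g₀ * n = n * g₀ := by
    intro n hn
    apply hinj
    rw [map_mul, map_mul, hg₀]
    exact (hz (toCompletion G n) (toCompletion_mem_commutatorKernel G hn)).symm
  -- if `g₀ ≠ 1`, its centralizer is cyclic and contains `x`, `y`: contradiction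
  by_contra hz1
  have hg₀1 : g₀ ≠ 1 := fun h => hz1 (by rw [← hg₀, h, map_one])
  haveI := hZ G hG g₀ hg₀1
  obtain ⟨r, hr⟩ := (Subgroup.isCyclic_iff_exists_zpowers_eq_top _).mp (hZ G hG g₀ hg₀1)
  have hxr : x ∈ Subgroup.zpowers r := by
    rw [hr, Subgroup.mem_centralizer_iff]
    intro w hw; rw [Set.mem_singleton_iff] at hw; subst hw
    exact hcomm x hx
  have hyr : y ∈ Subgroup.zpowers r := by
    rw [hr, Subgroup.mem_centralizer_iff]
    intro w hw; rw [Set.mem_singleton_iff] at hw; subst hw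
    exact hcomm y hy
  obtain ⟨i, rfl⟩ := Subgroup.mem_zpowers_iff.mp hxr
  obtain ⟨j, rfl⟩ := Subgroup.mem_zpowers_iff.mp hyr
  exact hxy (zpow_mul_comm r i j)

/-- **Lemma 2.7 (vi), the named statement `centralizerCommutatorKernelTrivial`, from (HCS), (III),
(Z), (FG) for orientable surface groups** (free half: t9's `centralizerCommutatorKernelTrivial_freeCase`).
[cite: Mochizuki2012, Lem 2.7(vi) pp.58-59] -/
theorem centralizerCommutatorKernelTrivial_of_surfaceHCS
    (hHCS : ∀ (S : Type u) [Group S], IsOrientableSurfaceGroup S → ∀ K : Subgroup S, K.FiniteIndex →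
      ∀ u v : K, ¬ IsConj u v → ∃ (L : Subgroup K) (_ : L.Normal) (_ : L.FiniteIndex),
        ¬ IsConj (QuotientGroup.mk u : K ⧸ L) (QuotientGroup.mk v))
    (hIII : ∀ (S : Type u) [Group S], IsOrientableSurfaceGroup S → ∀ x y : S, x * y ≠ y * x →
      ∃ (S₁ : Subgroup S) (n : ℕ) (hx : x ^ n ∈ S₁) (hy : y ^ n ∈ S₁), S₁.FiniteIndex ∧ 0 < n ∧
        ∀ i j : ℤ, Abelianization.of (⟨x ^ n, hx⟩ : S₁) ^ i *
          Abelianization.of (⟨y ^ n, hy⟩ : S₁) ^ j = 1 → i = 0 ∧ j = 0)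
    (hZ : ∀ (S : Type u) [Group S], IsOrientableSurfaceGroup S → ∀ u : S, u ≠ 1 →
      IsCyclic (Subgroup.centralizer ({u} : Set S)))
    (hFG : ∀ (S : Type u) [Group S], IsOrientableSurfaceGroup S → Group.FG S) :
    centralizerCommutatorKernelTrivial.{u} :=
  centralizerCommutatorKernelTrivial_of_surfaceCase fun G _ hG _ =>
    centralizerCommutatorKernelTrivial_surfaceCase_of_surfaceHCS hHCS hIII hZ hFG G hG

/-- **Lemma 2.7 (vii), the named statement `autFixingCommutatorKernelTrivial`, from the same four
properties** (the printed step (vi) ⇒ (vii), t1's `autFixingCommutatorKernelTrivial_of_centralizer`).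
[cite: Mochizuki2012, Lem 2.7(vii) p.59] -/
theorem autFixingCommutatorKernelTrivial_of_surfaceHCS
    (hHCS : ∀ (S : Type u) [Group S], IsOrientableSurfaceGroup S → ∀ K : Subgroup S, K.FiniteIndex →
      ∀ u v : K, ¬ IsConj u v → ∃ (L : Subgroup K) (_ : L.Normal) (_ : L.FiniteIndex),
        ¬ IsConj (QuotientGroup.mk u : K ⧸ L) (QuotientGroup.mk v))
    (hIII : ∀ (S : Type u) [Group S], IsOrientableSurfaceGroup S → ∀ x y : S, x * y ≠ y * x →
      ∃ (S₁ : Subgroup S) (n : ℕ) (hx : x ^ n ∈ S₁) (hy : y ^ n ∈ S₁), S₁.FiniteIndex ∧ 0 < n ∧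
        ∀ i j : ℤ, Abelianization.of (⟨x ^ n, hx⟩ : S₁) ^ i *
          Abelianization.of (⟨y ^ n, hy⟩ : S₁) ^ j = 1 → i = 0 ∧ j = 0)
    (hZ : ∀ (S : Type u) [Group S], IsOrientableSurfaceGroup S → ∀ u : S, u ≠ 1 →
      IsCyclic (Subgroup.centralizer ({u} : Set S)))
    (hFG : ∀ (S : Type u) [Group S], IsOrientableSurfaceGroup S → Group.FG S) :
    autFixingCommutatorKernelTrivial.{u} :=
  autFixingCommutatorKernelTrivial_of_centralizer
    (centralizerCommutatorKernelTrivial_of_surfaceHCS hHCS hIII hZ hFG)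

end FreeOrSurface

end Literature.IUT.HodgeTheaters
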